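import Summits.BirchSwinnertonDyer.BirchSwinnertonDyer.Theses.UniversalToricDescent
import Summits.BirchSwinnertonDyer.BirchSwinnertonDyer.Theorems.UniversalToricDescentTwinSplitIMCAtThreeSupsetGoodSS
import HarnessLib

/-!
# Route `UniversalToricDescent`: child crux `TwinSplitIMCAtThreeGoodSS` (item stmt-BirchSwinnertonDyer-20695, bucket C =
# 603/2 023 twin classes) BY NAME from its three missing inputs — the GLUE of line `threeframes` in fact-shaped form

Lead prover `bsd-wall-utd-p2` g4 (LINE mode on 20695, skeleton `threeframes` sha16 cd65a53edf482fd3: stubs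
`stub_howardFrameSS` / `stub_wanFrameSS` / `stub_muFrameSS`). This file proves, sorry-free, that the ROUTE DECL
`Theses.UniversalToricDescent.TwinSplitIMCAtThreeGoodSS` follows from exactly three named hypotheses:
* `hC` — the OPEN preprint claim `CastellaCiperianiSkinnerSprung2018.thm57_lemma55_…_OPEN` (Howard-direction
  divisibility + `Λ`-torsion at a good NON-ORDINARY odd prime split in `K`, `N⁻ = 1` allowed; unrefereed — the refereed
  Castella–Wan Math. Ann. 389 (2024) Thm. 5.12 is `p > 3`), which the line's `stub_howardFrameSS` is closed modulo
  (p546254 `exists_howardFrame_isTorsion_of_goodSS_of_ccss`);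
* `h422` — the refereed fact `BurungaleCastellaSkinner2025.prop422_exists_isBDPLFunction_mu_eq_zero` (Hsieh's
  `μ = 0`), which `stub_muFrameSS` is closed modulo (p539728 `exists_frame_mu_eq_zero_of_good`);
* `hWan` — the ∀-closure of the registered research stub `stub_wanFrameSS` VERBATIM: at every datum of the child, SOME
  BDP frame `L` with `3^k · Ch_Λ(X_{∅,0}(W′_K))·R₀⟦T⟧ ⊆ (L)` (the rational Wan direction at a good-supersingular `3`
  under the CLASSICAL Heegner hypothesis; no print at `p = 3`: Büyükboduk–Lei / BBL-I–II / Kobayashi–Ota are `p ≥ 5`,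
  Castella–Wan needs `N⁻ ≠ 1`, Burungale–Castella–Kim 2021's bipartite road has an empty admissible set at `3` and its
  rank-one road is the instance-level value route p550002).
So a planner's gen-2 split of 20695 into {by-name child for `hC` (HOLD until refereed), by-name child for `h422`,
research child with signature `hWan`} has its glue PROVED here (one `exact` over the landed
`UniversalToricDescentTwinSplit.twinSplit_instance_of_goodSS_of_ccss_of_wanFrame`). CONDITIONAL result (the gate
records `conditional-result`); it does NOT close 20695. Beyond-print BSD theorem: NO. `--supports stmt-BirchSwinnertonDyer-20695`.

References: [CastellaCiperianiSkinnerSprung2018] Thm. 5.7, Lemma 5.5 (arXiv:1804.10993v2 §5.1);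
[BurungaleCastellaSkinner2025] Prop. 4.2.2 (arXiv:2405.00270v2 pp. 8–9); [BurungaleCastellaKim2021] Thm. 1.3 and
Rem. 1.5 (Algebra Number Theory 15 (2021), arXiv:1908.09512 pp. 3–5); memo HOME/bsd-wall/bsd-wall-utd-p2/SUPSET-AT3-v6.md §7.
-/

noncomputable section

open scoped Classical

set_option linter.dupNamespace false
set_option autoImplicit false

namespace Summit.BirchSwinnertonDyer.BirchSwinnertonDyer.Theorems

open PowerSeries WeierstrassCurve NumberField IsDedekindDomain Field
  Literature.NumberTheory.EllipticCurves
  Literature.NumberTheory.EllipticCurves.ModularForms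
  Literature.NumberTheory.EllipticCurves.Rank1Residual
  Summit.BirchSwinnertonDyer.Rank1Residual.X11b
  Summit.BirchSwinnertonDyer.Rank1Residual.X11b.Halves
  Summit.BirchSwinnertonDyer.BirchSwinnertonDyer.Theorems.SchneiderFree

/-- **Child crux `TwinSplitIMCAtThreeGoodSS` (20695) from its three missing inputs.** If (a) the CÇSS18 claim
`hC` (Howard direction + torsion at good non-ordinary odd `p` split in `K`, `N⁻ = 1` allowed), (b) BCS 2025 Prop. 4.2.2
`h422` (a `μ = 0` BDP frame at a good prime) and (c) `hWan`: at every datum of the child some BDP frame `L` of `f_{W′}`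
at `(ι′, 𝔭)` satisfies `3^k · Ch_Λ(X_ac(W′_K) strict at 𝔭′)·R₀⟦T⟧ ⊆ (L)` for some `k` — then the route decl
`TwinSplitIMCAtThreeGoodSS` holds: conjunct (i) and the every-frame equality (ii) at every good-supersingular twin
with `ρ̄₃` onto, every Heegner `K` with `3` split and `d_K` odd. One `exact` over
`UniversalToricDescentTwinSplit.twinSplit_instance_of_goodSS_of_ccss_of_wanFrame`. CONDITIONAL on `hC` (OPEN claim),
`h422` (refereed named fact) and `hWan` (research; the ∀-closure of the registered stub `stub_wanFrameSS`).
[cite: CastellaCiperianiSkinnerSprung2018, Thm. 5.7, Lemma 5.5, proof of Thm. 5.8 (arXiv:1804.10993v2 §5.1)]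
[cite: BurungaleCastellaSkinner2025, Prop. 4.2.2 (§4.2, pp. 8–9 of arXiv:2405.00270v2)] -/
theorem twinSplitIMCAtThreeGoodSS_of_howardClaim_of_prop422_of_wanDivisibility
    (hC : CastellaCiperianiSkinnerSprung2018.thm57_lemma55_exists_isBDPLFunction_isTorsion_mem_charIdeal_OPEN)
    (h422 : BurungaleCastellaSkinner2025.prop422_exists_isBDPLFunction_mu_eq_zero)
    (hWan :
    ∀ (W' : WeierstrassCurve ℚ) [W'.IsElliptic] [W'.IsGloballyMinimal] (N' : ℕ) [NeZero N']
      (K : Type) [Field K] [NumberField K] (Dt' : ModularParametrizationData W' N'),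
      GoodSS W' 3 → W'.HasSurjectiveModNGaloisRep 3 → W'.conductorNorm ℤ = N' → IsImaginaryQuadratic K →
      SatisfiesHeegnerHypothesis N' K → Odd (NumberField.discr K) →
      ∀ (κ : ZpExtension K 3), κ.IsAnticyclotomic → ∀ (γ : absoluteGaloisGroup K) [Fact (κ.IsTopGenerator γ)]
        (𝔭 : HeightOneSpectrum (𝓞 K)), ((3 : ℕ) : 𝓞 K) ∈ 𝔭.asIdeal →
        𝔭.asIdeal.ramificationIdx (𝓞 ℚ) = 1 → 𝔭.asIdeal.inertiaDeg (𝓞 ℚ) = 1 →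
        ∀ (𝔭' : HeightOneSpectrum (𝓞 K)), ((3 : ℕ) : 𝓞 K) ∈ 𝔭'.asIdeal → 𝔭' ≠ 𝔭 →
        ∀ (ι' : PadicAlgCl 3 ≃+* ℂ), BranchInducesPrime 3 ι' 𝔭 →
        ∃ (ΩK : ℂ) (Ωp : ℂ_[3]) (L : UnrSeries 3), ΩK ≠ 0 ∧ Ωp ≠ 0 ∧
          IsBDPLFunction ι' 𝔭 κ γ Dt'.f ΩK Ωp L ∧
          ∃ k : ℕ, ∀ G ∈ (AcSelmer.XAc.charIdeal (W'.baseChange K) 3 κ 𝔭' ∅ γ).map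
            (PowerSeries.map (toUnr 3)), PowerSeries.C (((3 : ℕ) : unrIntegers 3) ^ k) * G ∈ Ideal.span {L}) :
    Summit.BirchSwinnertonDyer.BirchSwinnertonDyer.Theses.UniversalToricDescent.TwinSplitIMCAtThreeGoodSS := by
  intro W' _ _ N' _ K _ _ Dt' hss hsurj hN' hK hH hodd κ hκ γ _ 𝔭 h𝔭 he hf 𝔭' h𝔭' hne ι' hι'
  exact UniversalToricDescentTwinSplit.twinSplit_instance_of_goodSS_of_ccss_of_wanFrame hC h422 W' N' K Dt' hss
    hsurj hK hH hodd κ hκ γ 𝔭 h𝔭 he hf 𝔭' h𝔭' hne ι' hι'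
    (hWan W' N' K Dt' hss hsurj hN' hK hH hodd κ hκ γ 𝔭 h𝔭 he hf 𝔭' h𝔭' hne ι' hι')

end Summit.BirchSwinnertonDyer.BirchSwinnertonDyer.Theorems

end
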